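import Mathlib
import HarnessLib
import Summits.HubbardSuperconductivity.HubbardSuperconductivity.Theorems.KLProgrammeKLRegimeSectorSlicePairMoment
import Summits.HubbardSuperconductivity.HubbardSuperconductivity.Theorems.KLProgrammeKLRegimeTorusL1ThirdDifferencesMomentSpace

/-!
# Route `KLProgramme` — engine / VL support (route (L2), ADDITIVE weight, FIRST MOMENT, SECTIONAL): the FIXED-TIME weighted spatial `ℓ¹` norm of ONE
# sector-pair character sum of a sectorised slice covariance — the abstract assembly behind the «sectional row `eW′`» in the SECTOR currency

Cell `gate-hubbard-kl`, seat p3 (g11), for k3c4-p1's Λ-scaled two-volume step (`…TwoVolumeSrcSectorScaleSuccMinS`, hypothesis `hsecW'`; KL STATUS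
2026-08-28T00:46:49Z M3b-j (ii), «located; p3/k3c4-p2 currency»).  The all-times weighted row of the pair kernel `S(z) = Σ_q χ_{q₁}(z₁)χ_{q₂}(z₂)·G(q)`,
`G = c₀·M·Ψ̂`, is `…SectorSlicePairMoment.slicePairWt_charSum_l1_le`; the two-volume step also reads the SECTIONAL row — `z₁` (the time difference)
FIXED, sum over the spatial difference `z₂` only, weight `1 + s₁|z̃₂|₁` — which must come out free of `ε = β/(2M)` and of `Λ`.  Route: the triangle
inequality in the frequency variable, `‖S(z₁,z₂)‖ ≤ Σ_{q₁} ‖Σ_k χ_k(z₂)·G(q₁,k)‖` (`|χ_{q₁}(z₁)| = 1`), then the SPACE-ONLY corollary of the mixed-orders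
master lemma (`sum_wt_norm_charSum_space_le_of_mixed_differences`, …TorusL1ThirdDifferencesMomentSpace) for each frequency section `k ↦ G(q₁,k)`,
whose spatial differences ARE the `(0, r)`-differences of `G` (§1), summed over the `N_t` frequencies meeting the support of `M`:

* §1 `fwdDiff_iter_section` — `Δ_rⁿ (k ↦ g(a,k)) k = Δ_{(0,r)}ⁿ g (a,k)`; `norm_charSum_section_le` — the triangle inequality in `q₁`;
* §2 **`sliceCharSumWt_sectional_le_of_mixed_data`** — abstract assembly: if `#{q₁ : ∃k, M(q₁,k) ≠ 0} ≤ N_t`, `#{k : M(q₁,k) ≠ 0} ≤ N_sp` for every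
  `q₁`, `‖G‖ ≤ A₀`, and the four SPATIAL single-direction difference bounds of `slicePairWt_charSum_l1_le` hold (`e₁,e₂` / `v⊥` / `v` order 2 / `v`
  order 3 at rates `s₁ / s₂ / s₃ / s₃′`), then for EVERY `z₁`
  `Σ_{z₂} (1 + s₁|z̃₂,₁| + s₁|z̃₂,₂|)·‖S(z₁,z₂)‖ ≤ N_t · √(524288(1/s₀+1)[…]) · √(24·L²·N_sp) · A₀` (`s₀ > 0` free);
* §3 **`slicePairWt_charSum_l1_sectional_le`** — the model twin of `slicePairWt_charSum_l1_le` (same multiplier data minus the time differences, same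
  frame/cutoff data, same four spatial rate inequalities `hr₁ hr₂ hr₃ hr₃′`, plus the two support counts): the sectional weighted row of the pair kernel
  of `S(F)ᵀ·C^{K}_{(Λ,Λ′]}·S(F)` is `≤ N_t·√(…)·√(24·L²·N_sp)·(1/(βL²))²·(4βL²/Λ)` uniformly in the time difference.
Size check (rates as in …AlphaWtClosed, `N_t ≍ βΛ′`, `N_sp ≍ L²Λ^{3/2}`): the all-times row is `≍ (M/β)/Λ`, the sectional one `≍ 1` — ε-free, Λ-free.

Everything is proved; no definitions, no named facts; nothing about the model is asserted. [folklore]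
References: G. Benfatto, A. Giuliani, V. Mastropietro, Ann. Henri Poincaré 7 (2006) 809–898, Lemma 2.2 (2.52)–(2.55), §2.8 (2.81), §3 (3.3).
-/

noncomputable section

namespace Summit.HubbardSuperconductivity.HubbardSuperconductivity.Theorems.TorusFourierL2

set_option linter.dupNamespace false -- summit = problem name (single-conjunct summit), D-0017

open Finset Complex Literature.MathematicalPhysics.QuantumLattice Literature.Probability.LatticeModels
open Summit.HubbardSuperconductivity.HubbardSuperconductivity.Theorems.DispersionFlow
open scoped Real

/-! ### §1 Sections at a fixed frequency -/

section Section

/-- **Iterated differences of a frequency section**: `Δ_rⁿ (k ↦ g(a,k)) k = Δ_{(0,r)}ⁿ g (a,k)`. [folklore] -/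
theorem fwdDiff_iter_section {A B E : Type*} [AddCommMonoid A] [AddCommMonoid B] [AddCommGroup E] (g : A × B → E) (a : A) (r : B) (n : ℕ) (k : B) :
    ((fwdDiff r)^[n] (fun k' : B => g (a, k'))) k = ((fwdDiff ((0 : A), r))^[n] g) (a, k) := by
  rw [fwdDiff_iter_eq_sum_shift, fwdDiff_iter_eq_sum_shift]
  refine sum_congr rfl fun j _ => ?_
  simp [Prod.smul_mk]

/-- **The triangle inequality in the frequency variable**: `‖Σ_q χ_{q₁}(z₁)χ_{q₂}(z₂)·G(q)‖ ≤ Σ_{q₁ ∈ T} ‖Σ_k χ_k(z₂)·G(q₁,k)‖` for any set `T` of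
frequencies outside which `G` vanishes. [folklore] -/
theorem norm_charSum_section_le {P L : ℕ} [NeZero P] [NeZero L] (G : TorusSite 1 P × TorusSite 2 L → ℂ) (T : Finset (TorusSite 1 P))
    (hT : ∀ q₁, q₁ ∉ T → ∀ k, G (q₁, k) = 0) (z₁ : TorusSite 1 P) (z₂ : TorusSite 2 L) :
    ‖∑ q : TorusSite 1 P × TorusSite 2 L, (torusChar q.1 z₁ * torusChar q.2 z₂) • G q‖ ≤
      ∑ q₁ ∈ T, ‖∑ k : TorusSite 2 L, torusChar k z₂ • G (q₁, k)‖ := by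
  classical
  rw [Fintype.sum_prod_type]
  have hsplit : ∑ q₁ : TorusSite 1 P, ∑ k : TorusSite 2 L, (torusChar (q₁, k).1 z₁ * torusChar (q₁, k).2 z₂) • G (q₁, k) =
      ∑ q₁ ∈ T, torusChar q₁ z₁ • ∑ k : TorusSite 2 L, torusChar k z₂ • G (q₁, k) := by
    rw [← Finset.sum_subset (subset_univ T)]
    · refine sum_congr rfl fun q₁ _ => ?_
      rw [Finset.smul_sum]
      refine sum_congr rfl fun k _ => ?_
      rw [smul_smul]
    · intro q₁ _ hq₁
      exact sum_eq_zero fun k _ => by rw [hT q₁ hq₁ k, smul_zero]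
  rw [hsplit]
  refine (norm_sum_le _ _).trans (sum_le_sum fun q₁ _ => ?_)
  rw [norm_smul, norm_torusChar, one_mul]

end Section

/-! ### §2 The abstract sectional assembly -/

section Abstract

/-- **The SECTIONAL weighted `ℓ¹` bound of a pair character sum from spatial mixed-order data** (see the module docstring): uniformly in the time
difference `z₁`. [cite: BenfattoGiulianiMastropietro2006, Lemma 2.2 (2.52)–(2.55), §2.8 (2.81)] -/
theorem sliceCharSumWt_sectional_le_of_mixed_data {P L : ℕ} [NeZero P] [NeZero L] (c₀ : ℂ) (Mf Ψ : TorusSite 1 P × TorusSite 2 L → ℂ)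
    (v : Fin 2 → ℤ) (hv : v ≠ 0) {s₀ s₁ s₂ s₃ s₃' : ℝ} (hs₀ : 0 < s₀) (hs₁ : 0 < s₁) (hs₂ : 0 < s₂) (hs₃ : 0 < s₃) (hs₃' : 0 < s₃')
    {R₀ : ℕ} (hR₀ : 2 * (|v 0| + |v 1|) * (R₀ : ℤ) < L) {A₀ : ℝ} (hA₀ : 0 ≤ A₀) {Nt Nsp : ℕ}
    (hsuppT : (univ.filter fun q₁ : TorusSite 1 P => ∃ k, Mf (q₁, k) ≠ 0).card ≤ Nt)
    (hsuppS : ∀ q₁ : TorusSite 1 P, (univ.filter fun k : TorusSite 2 L => Mf (q₁, k) ≠ 0).card ≤ Nsp)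
    (hsup : ∀ q, ‖c₀ * (Mf q * Ψ q)‖ ≤ A₀)
    (h₁ : ∀ q (i : Fin 2), ‖(fwdDiff ((0 : TorusSite 1 P), (Pi.single i (1 : ZMod L) : TorusSite 2 L)))^[3]
        (fun y => c₀ * (Mf y * Ψ y)) q‖ ≤ A₀ * (4 / (s₁ * L)) ^ 3)
    (h₂ : ∀ q, ‖(fwdDiff ((0 : TorusSite 1 P), (fun j => ((![-v 1, v 0] j : ℤ) : ZMod L))))^[3]
        (fun y => c₀ * (Mf y * Ψ y)) q‖ ≤ A₀ * (4 / (s₂ * L)) ^ 3)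
    (h₃ : ∀ q, ‖(fwdDiff ((0 : TorusSite 1 P), (fun j => ((v j : ℤ) : ZMod L))))^[2] (fun y => c₀ * (Mf y * Ψ y)) q‖ ≤
        A₀ * (4 / (s₃ * L)) ^ 2)
    (h₃' : ∀ q, ‖(fwdDiff ((0 : TorusSite 1 P), (fun j => ((v j : ℤ) : ZMod L))))^[3] (fun y => c₀ * (Mf y * Ψ y)) q‖ ≤
        A₀ * (4 / (s₃' * L)) ^ 3) (z₁ : TorusSite 1 P) :
    ∑ z₂ : TorusSite 2 L, (1 + s₁ * |(((z₂ 0).valMinAbs : ℤ) : ℝ)| + s₁ * |(((z₂ 1).valMinAbs : ℤ) : ℝ)|) *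
        ‖∑ q : TorusSite 1 P × TorusSite 2 L, (torusChar q.1 z₁ * torusChar q.2 z₂) • (c₀ * (Mf q * Ψ q))‖ ≤
      Nt * (Real.sqrt (524288 * (1 / s₀ + 1) *
          ((1 + 2 * Real.sqrt 2 * s₁ / (s₂ * Real.sqrt ((v 0 : ℝ) ^ 2 + (v 1 : ℝ) ^ 2)) +
              2 * Real.sqrt 2 * s₁ / (s₃' * Real.sqrt ((v 0 : ℝ) ^ 2 + (v 1 : ℝ) ^ 2))) ^ 2 *
            ((2 * Real.sqrt 2 / (s₂ * Real.sqrt ((v 0 : ℝ) ^ 2 + (v 1 : ℝ) ^ 2)) + 2) *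
              (2 * Real.sqrt 2 / (s₃ * Real.sqrt ((v 0 : ℝ) ^ 2 + (v 1 : ℝ) ^ 2)) + 2))
            + (1 / s₁ + 1) ^ 2 / (1 + s₁ * R₀))) *
        Real.sqrt (24 * (L : ℝ) ^ 2 * Nsp) * A₀) := by
  classical
  set G : TorusSite 1 P × TorusSite 2 L → ℂ := fun q => c₀ * (Mf q * Ψ q) with hG
  set T : Finset (TorusSite 1 P) := univ.filter fun q₁ : TorusSite 1 P => ∃ k, Mf (q₁, k) ≠ 0 with hTdef
  set Cst : ℝ := Real.sqrt (524288 * (1 / s₀ + 1) *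
          ((1 + 2 * Real.sqrt 2 * s₁ / (s₂ * Real.sqrt ((v 0 : ℝ) ^ 2 + (v 1 : ℝ) ^ 2)) +
              2 * Real.sqrt 2 * s₁ / (s₃' * Real.sqrt ((v 0 : ℝ) ^ 2 + (v 1 : ℝ) ^ 2))) ^ 2 *
            ((2 * Real.sqrt 2 / (s₂ * Real.sqrt ((v 0 : ℝ) ^ 2 + (v 1 : ℝ) ^ 2)) + 2) *
              (2 * Real.sqrt 2 / (s₃ * Real.sqrt ((v 0 : ℝ) ^ 2 + (v 1 : ℝ) ^ 2)) + 2))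
            + (1 / s₁ + 1) ^ 2 / (1 + s₁ * R₀))) *
        Real.sqrt (24 * (L : ℝ) ^ 2 * Nsp) * A₀ with hCst
  have hCst0 : 0 ≤ Cst := by rw [hCst]; positivity
  -- outside `T` the symbol vanishes
  have hT : ∀ q₁, q₁ ∉ T → ∀ k, G (q₁, k) = 0 := by
    intro q₁ hq₁ k
    by_contra hne
    exact hq₁ (by rw [hTdef, mem_filter]; exact ⟨mem_univ _, k, fun h => hne (by simp [hG, h])⟩)
  -- each frequency section obeys the space-only bound
  have hsec : ∀ q₁ : TorusSite 1 P, ∑ z₂ : TorusSite 2 L, (1 + s₁ * |(((z₂ 0).valMinAbs : ℤ) : ℝ)| + s₁ * |(((z₂ 1).valMinAbs : ℤ) : ℝ)|) *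
      ‖∑ k : TorusSite 2 L, torusChar k z₂ • G (q₁, k)‖ ≤ Cst := by
    intro q₁
    have hsuppk : (univ.filter fun k : TorusSite 2 L => G (q₁, k) ≠ 0).card ≤ Nsp := by
      refine le_trans (card_le_card fun k hk => ?_) (hsuppS q₁)
      rw [mem_filter] at hk ⊢
      refine ⟨hk.1, fun h => hk.2 ?_⟩
      simp [hG, h]
    have e1 : ∀ (r : TorusSite 2 L) (n : ℕ) (k : TorusSite 2 L),
        ((fwdDiff r)^[n] (fun k' : TorusSite 2 L => G (q₁, k'))) k = ((fwdDiff ((0 : TorusSite 1 P), r))^[n] G) (q₁, k) :=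
      fun r n k => fwdDiff_iter_section G q₁ r n k
    exact sum_wt_norm_charSum_space_le_of_mixed_differences (fun k => G (q₁, k)) v hv hs₀ hs₁ hs₂ hs₃ hs₃' hR₀ hA₀ hsuppk
      (fun k => hsup (q₁, k)) (fun k i => by rw [e1]; exact h₁ (q₁, k) i) (fun k => by rw [e1]; exact h₂ (q₁, k))
      (fun k => by rw [e1]; exact h₃ (q₁, k)) (fun k => by rw [e1]; exact h₃' (q₁, k))
  -- triangle inequality in the frequency, then sum the sections
  calc ∑ z₂ : TorusSite 2 L, (1 + s₁ * |(((z₂ 0).valMinAbs : ℤ) : ℝ)| + s₁ * |(((z₂ 1).valMinAbs : ℤ) : ℝ)|) *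
        ‖∑ q : TorusSite 1 P × TorusSite 2 L, (torusChar q.1 z₁ * torusChar q.2 z₂) • G q‖
      ≤ ∑ z₂ : TorusSite 2 L, (1 + s₁ * |(((z₂ 0).valMinAbs : ℤ) : ℝ)| + s₁ * |(((z₂ 1).valMinAbs : ℤ) : ℝ)|) *
          ∑ q₁ ∈ T, ‖∑ k : TorusSite 2 L, torusChar k z₂ • G (q₁, k)‖ :=
        sum_le_sum fun z₂ _ => mul_le_mul_of_nonneg_left (norm_charSum_section_le G T hT z₁ z₂) (by positivity)
    _ = ∑ q₁ ∈ T, ∑ z₂ : TorusSite 2 L, (1 + s₁ * |(((z₂ 0).valMinAbs : ℤ) : ℝ)| + s₁ * |(((z₂ 1).valMinAbs : ℤ) : ℝ)|) *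
          ‖∑ k : TorusSite 2 L, torusChar k z₂ • G (q₁, k)‖ := by
        rw [sum_comm]; exact sum_congr rfl fun z₂ _ => mul_sum _ _ _
    _ ≤ ∑ q₁ ∈ T, Cst := sum_le_sum fun q₁ _ => hsec q₁
    _ = T.card * Cst := by rw [sum_const, nsmul_eq_mul]
    _ ≤ Nt * Cst := mul_le_mul_of_nonneg_right (by exact_mod_cast hsuppT) hCst0

end Abstract

/-! ### §3 The model: the sectional weighted row of ONE sector pair of `S(F)ᵀ·C^{K}_{(Λ,Λ′]}·S(F)` -/

section Pair

variable {L M : ℕ} [NeZero L] [NeZero M]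

set_option maxHeartbeats 400000 in
/-- **The per-pair SECTIONAL weighted `ℓ¹` bound from multiplier data** — the fixed-time twin of `slicePairWt_charSum_l1_le` (same data minus the
time differences of the multiplier and the time rate inequality; plus the two support counts `N_t`, `N_sp`); uniform in the time difference `z₁`.
(One disclosed heartbeat raise, as in the all-times lemma: the four explicit rate inequalities make the statement large.)
[cite: BenfattoGiulianiMastropietro2006, §2.8 (2.81), Lemma 2.2 (2.52)–(2.55), §3 (3.3)] -/
theorem slicePairWt_charSum_l1_sectional_le {β μ Λ Λ' : ℝ} {K : TrigPolyC4v} (hβ : 0 < β) (hΛ : 0 < Λ) (hΛΛ' : Λ ≤ Λ')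
    {K₁ K₂ K₃ : ℝ} (hK₁ : ∀ p, ‖fderiv ℝ (frameLevel μ K) p‖ ≤ K₁) (hK₂ : ∀ p, ‖iteratedFDeriv ℝ 2 (frameLevel μ K) p‖ ≤ K₂)
    (hK₃ : ∀ p, ‖iteratedFDeriv ℝ 3 (frameLevel μ K) p‖ ≤ K₃)
    {B₁ B₂ B₃ : ℝ} (hB₁ : ∀ x, |deriv salmhoferCutoff x| ≤ B₁) (hB₂ : ∀ x, |deriv (deriv salmhoferCutoff) x| ≤ B₂)
    (hB₃ : ∀ x, |deriv (deriv (deriv salmhoferCutoff)) x| ≤ B₃)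
    -- multiplier data
    (Mf : TorusSite 1 (2 * M) × TorusSite 2 L → ℂ) (hM0 : ∀ q, ‖Mf q‖ ≤ 1)
    (v : Fin 2 → ℤ) (hv : v ≠ 0) {R₀ : ℕ} (hR₀ : 2 * (|v 0| + |v 1|) * (R₀ : ℤ) < L)
    {Nt Nsp : ℕ} (hsuppT : (univ.filter fun q₁ : TorusSite 1 (2 * M) => ∃ k, Mf (q₁, k) ≠ 0).card ≤ Nt)
    (hsuppS : ∀ q₁ : TorusSite 1 (2 * M), (univ.filter fun k : TorusSite 2 L => Mf (q₁, k) ≠ 0).card ≤ Nsp)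
    (ae₁ ae₂ ae₃ : Fin 2 → ℝ) (hae₁ : ∀ i, 0 ≤ ae₁ i) (hae₂ : ∀ i, 0 ≤ ae₂ i) (hae₃ : ∀ i, 0 ≤ ae₃ i)
    (hMe₁ : ∀ q (i : Fin 2), ‖fwdDiff ((0 : TorusSite 1 (2 * M)), (Pi.single i (1 : ZMod L) : TorusSite 2 L)) Mf q‖ ≤ ae₁ i)
    (hMe₂ : ∀ q (i : Fin 2), ‖(fwdDiff ((0 : TorusSite 1 (2 * M)), (Pi.single i (1 : ZMod L) : TorusSite 2 L)))^[2] Mf q‖ ≤ ae₂ i)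
    (hMe₃ : ∀ q (i : Fin 2), ‖(fwdDiff ((0 : TorusSite 1 (2 * M)), (Pi.single i (1 : ZMod L) : TorusSite 2 L)))^[3] Mf q‖ ≤ ae₃ i)
    {an₁ an₂ an₃ : ℝ} (han₁ : 0 ≤ an₁) (han₂ : 0 ≤ an₂) (han₃ : 0 ≤ an₃)
    (hMn₁ : ∀ q, ‖fwdDiff ((0 : TorusSite 1 (2 * M)), (fun j => ((![-v 1, v 0] j : ℤ) : ZMod L))) Mf q‖ ≤ an₁)
    (hMn₂ : ∀ q, ‖(fwdDiff ((0 : TorusSite 1 (2 * M)), (fun j => ((![-v 1, v 0] j : ℤ) : ZMod L))))^[2] Mf q‖ ≤ an₂)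
    (hMn₃ : ∀ q, ‖(fwdDiff ((0 : TorusSite 1 (2 * M)), (fun j => ((![-v 1, v 0] j : ℤ) : ZMod L))))^[3] Mf q‖ ≤ an₃)
    {av₁ av₂ av₃ : ℝ} (hav₁ : 0 ≤ av₁) (hav₂ : 0 ≤ av₂) (hav₃ : 0 ≤ av₃)
    (hMv₁ : ∀ q, ‖fwdDiff ((0 : TorusSite 1 (2 * M)), (fun j => ((v j : ℤ) : ZMod L))) Mf q‖ ≤ av₁)
    (hMv₂ : ∀ q, ‖(fwdDiff ((0 : TorusSite 1 (2 * M)), (fun j => ((v j : ℤ) : ZMod L))))^[2] Mf q‖ ≤ av₂)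
    (hMv₃ : ∀ q, ‖(fwdDiff ((0 : TorusSite 1 (2 * M)), (fun j => ((v j : ℤ) : ZMod L))))^[3] Mf q‖ ≤ av₃)
    {τ : ℝ} (hτ0 : 0 ≤ τ)
    (hτ : ∀ q, Mf q ≠ 0 → |fderiv ℝ (frameLevel μ K) (WithLp.toLp 2 (torusCentredMomentum L q.2))
      (WithLp.toLp 2 (fun i => 2 * π / L * (v i : ℝ)))| ≤ τ)
    -- rates and the six inequalities (`c = βL²`, `w_r = toLp ((2π/L)·r)`)
    {s₀ s₁ s₂ s₃ s₃' : ℝ} (hs₀ : 0 < s₀) (hs₁ : 0 < s₁) (hs₂ : 0 < s₂) (hs₃ : 0 < s₃) (hs₃' : 0 < s₃')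
    (hr₁ : ∀ i : Fin 2, (1 / (β * (L : ℝ) ^ 2)) ^ 2 *
        (1 * ((64 * B₃ + 480 * B₂ + 1728 * B₁ + 1536) * (β * (L : ℝ) ^ 2) / Λ ^ 4 *
              (K₁ * ‖(WithLp.toLp 2 (fun j => 2 * π / L * ((Pi.single i (1 : ℤ) : Fin 2 → ℤ) j : ℝ)) : EuclideanSpace ℝ (Fin 2))‖ +
                6 * (K₂ * ‖(WithLp.toLp 2 (fun j => 2 * π / L * ((Pi.single i (1 : ℤ) : Fin 2 → ℤ) j : ℝ)) :
                  EuclideanSpace ℝ (Fin 2))‖ ^ 2)) ^ 3 +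
            3 * ((32 * B₂ + 144 * B₁ + 128) * (β * (L : ℝ) ^ 2) / Λ ^ 3 *
              (K₁ * ‖(WithLp.toLp 2 (fun j => 2 * π / L * ((Pi.single i (1 : ℤ) : Fin 2 → ℤ) j : ℝ)) : EuclideanSpace ℝ (Fin 2))‖ +
                6 * (K₂ * ‖(WithLp.toLp 2 (fun j => 2 * π / L * ((Pi.single i (1 : ℤ) : Fin 2 → ℤ) j : ℝ)) :
                  EuclideanSpace ℝ (Fin 2))‖ ^ 2)) *
              (K₂ * ‖(WithLp.toLp 2 (fun j => 2 * π / L * ((Pi.single i (1 : ℤ) : Fin 2 → ℤ) j : ℝ)) : EuclideanSpace ℝ (Fin 2))‖ ^ 2)) +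
            (16 * B₁ + 16) * (β * (L : ℝ) ^ 2) / Λ ^ 2 *
              (K₃ * ‖(WithLp.toLp 2 (fun j => 2 * π / L * ((Pi.single i (1 : ℤ) : Fin 2 → ℤ) j : ℝ)) : EuclideanSpace ℝ (Fin 2))‖ ^ 3)) +
          3 * (ae₁ i * ((32 * B₂ + 144 * B₁ + 128) * (β * (L : ℝ) ^ 2) / Λ ^ 3 *
              (K₁ * ‖(WithLp.toLp 2 (fun j => 2 * π / L * ((Pi.single i (1 : ℤ) : Fin 2 → ℤ) j : ℝ)) : EuclideanSpace ℝ (Fin 2))‖ +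
                5 * (K₂ * ‖(WithLp.toLp 2 (fun j => 2 * π / L * ((Pi.single i (1 : ℤ) : Fin 2 → ℤ) j : ℝ)) :
                  EuclideanSpace ℝ (Fin 2))‖ ^ 2)) ^ 2 +
            (16 * B₁ + 16) * (β * (L : ℝ) ^ 2) / Λ ^ 2 *
              (K₂ * ‖(WithLp.toLp 2 (fun j => 2 * π / L * ((Pi.single i (1 : ℤ) : Fin 2 → ℤ) j : ℝ)) : EuclideanSpace ℝ (Fin 2))‖ ^ 2))) +
          3 * (ae₂ i * ((16 * B₁ + 16) * (β * (L : ℝ) ^ 2) / Λ ^ 2 *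
              (K₁ * ‖(WithLp.toLp 2 (fun j => 2 * π / L * ((Pi.single i (1 : ℤ) : Fin 2 → ℤ) j : ℝ)) : EuclideanSpace ℝ (Fin 2))‖ +
                4 * (K₂ * ‖(WithLp.toLp 2 (fun j => 2 * π / L * ((Pi.single i (1 : ℤ) : Fin 2 → ℤ) j : ℝ)) :
                  EuclideanSpace ℝ (Fin 2))‖ ^ 2)))) +
          ae₃ i * (4 * (β * (L : ℝ) ^ 2) / Λ)) ≤
      (1 / (β * (L : ℝ) ^ 2)) ^ 2 * (4 * (β * (L : ℝ) ^ 2) / Λ) * (4 / (s₁ * L)) ^ 3)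
    (hr₂ : (1 / (β * (L : ℝ) ^ 2)) ^ 2 *
        (1 * ((64 * B₃ + 480 * B₂ + 1728 * B₁ + 1536) * (β * (L : ℝ) ^ 2) / Λ ^ 4 *
              (K₁ * ‖(WithLp.toLp 2 (fun j => 2 * π / L * ((![-v 1, v 0] : Fin 2 → ℤ) j : ℝ)) : EuclideanSpace ℝ (Fin 2))‖ +
                6 * (K₂ * ‖(WithLp.toLp 2 (fun j => 2 * π / L * ((![-v 1, v 0] : Fin 2 → ℤ) j : ℝ)) : EuclideanSpace ℝ (Fin 2))‖ ^ 2)) ^ 3 +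
            3 * ((32 * B₂ + 144 * B₁ + 128) * (β * (L : ℝ) ^ 2) / Λ ^ 3 *
              (K₁ * ‖(WithLp.toLp 2 (fun j => 2 * π / L * ((![-v 1, v 0] : Fin 2 → ℤ) j : ℝ)) : EuclideanSpace ℝ (Fin 2))‖ +
                6 * (K₂ * ‖(WithLp.toLp 2 (fun j => 2 * π / L * ((![-v 1, v 0] : Fin 2 → ℤ) j : ℝ)) : EuclideanSpace ℝ (Fin 2))‖ ^ 2)) *
              (K₂ * ‖(WithLp.toLp 2 (fun j => 2 * π / L * ((![-v 1, v 0] : Fin 2 → ℤ) j : ℝ)) : EuclideanSpace ℝ (Fin 2))‖ ^ 2)) +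
            (16 * B₁ + 16) * (β * (L : ℝ) ^ 2) / Λ ^ 2 *
              (K₃ * ‖(WithLp.toLp 2 (fun j => 2 * π / L * ((![-v 1, v 0] : Fin 2 → ℤ) j : ℝ)) : EuclideanSpace ℝ (Fin 2))‖ ^ 3)) +
          3 * (an₁ * ((32 * B₂ + 144 * B₁ + 128) * (β * (L : ℝ) ^ 2) / Λ ^ 3 *
              (K₁ * ‖(WithLp.toLp 2 (fun j => 2 * π / L * ((![-v 1, v 0] : Fin 2 → ℤ) j : ℝ)) : EuclideanSpace ℝ (Fin 2))‖ +
                5 * (K₂ * ‖(WithLp.toLp 2 (fun j => 2 * π / L * ((![-v 1, v 0] : Fin 2 → ℤ) j : ℝ)) : EuclideanSpace ℝ (Fin 2))‖ ^ 2)) ^ 2 +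
            (16 * B₁ + 16) * (β * (L : ℝ) ^ 2) / Λ ^ 2 *
              (K₂ * ‖(WithLp.toLp 2 (fun j => 2 * π / L * ((![-v 1, v 0] : Fin 2 → ℤ) j : ℝ)) : EuclideanSpace ℝ (Fin 2))‖ ^ 2))) +
          3 * (an₂ * ((16 * B₁ + 16) * (β * (L : ℝ) ^ 2) / Λ ^ 2 *
              (K₁ * ‖(WithLp.toLp 2 (fun j => 2 * π / L * ((![-v 1, v 0] : Fin 2 → ℤ) j : ℝ)) : EuclideanSpace ℝ (Fin 2))‖ +
                4 * (K₂ * ‖(WithLp.toLp 2 (fun j => 2 * π / L * ((![-v 1, v 0] : Fin 2 → ℤ) j : ℝ)) : EuclideanSpace ℝ (Fin 2))‖ ^ 2)))) +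
          an₃ * (4 * (β * (L : ℝ) ^ 2) / Λ)) ≤
      (1 / (β * (L : ℝ) ^ 2)) ^ 2 * (4 * (β * (L : ℝ) ^ 2) / Λ) * (4 / (s₂ * L)) ^ 3)
    (hr₃ : (1 / (β * (L : ℝ) ^ 2)) ^ 2 *
        (1 * ((32 * B₂ + 144 * B₁ + 128) * (β * (L : ℝ) ^ 2) / Λ ^ 3 *
              (τ + 4 * (K₂ * ‖(WithLp.toLp 2 (fun j => 2 * π / L * (v j : ℝ)) : EuclideanSpace ℝ (Fin 2))‖ ^ 2)) ^ 2 +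
            (16 * B₁ + 16) * (β * (L : ℝ) ^ 2) / Λ ^ 2 *
              (K₂ * ‖(WithLp.toLp 2 (fun j => 2 * π / L * (v j : ℝ)) : EuclideanSpace ℝ (Fin 2))‖ ^ 2)) +
          2 * (av₁ * ((16 * B₁ + 16) * (β * (L : ℝ) ^ 2) / Λ ^ 2 *
              (τ + 3 * (K₂ * ‖(WithLp.toLp 2 (fun j => 2 * π / L * (v j : ℝ)) : EuclideanSpace ℝ (Fin 2))‖ ^ 2)))) +
          av₂ * (4 * (β * (L : ℝ) ^ 2) / Λ)) ≤
      (1 / (β * (L : ℝ) ^ 2)) ^ 2 * (4 * (β * (L : ℝ) ^ 2) / Λ) * (4 / (s₃ * L)) ^ 2)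
    (hr₃' : (1 / (β * (L : ℝ) ^ 2)) ^ 2 *
        (1 * ((64 * B₃ + 480 * B₂ + 1728 * B₁ + 1536) * (β * (L : ℝ) ^ 2) / Λ ^ 4 *
              (τ + 6 * (K₂ * ‖(WithLp.toLp 2 (fun j => 2 * π / L * (v j : ℝ)) : EuclideanSpace ℝ (Fin 2))‖ ^ 2)) ^ 3 +
            3 * ((32 * B₂ + 144 * B₁ + 128) * (β * (L : ℝ) ^ 2) / Λ ^ 3 *
              (τ + 6 * (K₂ * ‖(WithLp.toLp 2 (fun j => 2 * π / L * (v j : ℝ)) : EuclideanSpace ℝ (Fin 2))‖ ^ 2)) *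
              (K₂ * ‖(WithLp.toLp 2 (fun j => 2 * π / L * (v j : ℝ)) : EuclideanSpace ℝ (Fin 2))‖ ^ 2)) +
            (16 * B₁ + 16) * (β * (L : ℝ) ^ 2) / Λ ^ 2 *
              (K₃ * ‖(WithLp.toLp 2 (fun j => 2 * π / L * (v j : ℝ)) : EuclideanSpace ℝ (Fin 2))‖ ^ 3)) +
          3 * (av₁ * ((32 * B₂ + 144 * B₁ + 128) * (β * (L : ℝ) ^ 2) / Λ ^ 3 *
              (τ + 5 * (K₂ * ‖(WithLp.toLp 2 (fun j => 2 * π / L * (v j : ℝ)) : EuclideanSpace ℝ (Fin 2))‖ ^ 2)) ^ 2 +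
            (16 * B₁ + 16) * (β * (L : ℝ) ^ 2) / Λ ^ 2 *
              (K₂ * ‖(WithLp.toLp 2 (fun j => 2 * π / L * (v j : ℝ)) : EuclideanSpace ℝ (Fin 2))‖ ^ 2))) +
          3 * (av₂ * ((16 * B₁ + 16) * (β * (L : ℝ) ^ 2) / Λ ^ 2 *
              (τ + 4 * (K₂ * ‖(WithLp.toLp 2 (fun j => 2 * π / L * (v j : ℝ)) : EuclideanSpace ℝ (Fin 2))‖ ^ 2)))) +
          av₃ * (4 * (β * (L : ℝ) ^ 2) / Λ)) ≤
      (1 / (β * (L : ℝ) ^ 2)) ^ 2 * (4 * (β * (L : ℝ) ^ 2) / Λ) * (4 / (s₃' * L)) ^ 3) :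
    ∀ z₁ : TorusSite 1 (2 * M), ∑ z₂ : TorusSite 2 L,
        (1 + s₁ * |(((z₂ 0).valMinAbs : ℤ) : ℝ)| + s₁ * |(((z₂ 1).valMinAbs : ℤ) : ℝ)|) *
        ‖∑ q : TorusSite 1 (2 * M) × TorusSite 2 L, (torusChar q.1 z₁ * torusChar q.2 z₂) •
          ((((1 / (β * (L : ℝ) ^ 2) : ℝ) : ℂ) ^ 2 *
            (Mf q * sliceSymbolFnXi (β * (L : ℝ) ^ 2) 0 Λ Λ' (matsubaraFreq β M ⟨(q.1 0).val, ZMod.val_lt (q.1 0)⟩)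
              (nambuXiCT L μ K q.2))))‖ ≤
      Nt * (Real.sqrt (524288 * (1 / s₀ + 1) *
          ((1 + 2 * Real.sqrt 2 * s₁ / (s₂ * Real.sqrt ((v 0 : ℝ) ^ 2 + (v 1 : ℝ) ^ 2)) +
              2 * Real.sqrt 2 * s₁ / (s₃' * Real.sqrt ((v 0 : ℝ) ^ 2 + (v 1 : ℝ) ^ 2))) ^ 2 *
            ((2 * Real.sqrt 2 / (s₂ * Real.sqrt ((v 0 : ℝ) ^ 2 + (v 1 : ℝ) ^ 2)) + 2) *
              (2 * Real.sqrt 2 / (s₃ * Real.sqrt ((v 0 : ℝ) ^ 2 + (v 1 : ℝ) ^ 2)) + 2))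
            + (1 / s₁ + 1) ^ 2 / (1 + s₁ * R₀))) *
        Real.sqrt (24 * (L : ℝ) ^ 2 * Nsp) * ((1 / (β * (L : ℝ) ^ 2)) ^ 2 * (4 * (β * (L : ℝ) ^ 2) / Λ))) := by
  classical
  -- abbreviations
  set c : ℝ := β * (L : ℝ) ^ 2 with hc_def
  have hc : 0 ≤ c := by positivity
  set c₀ : ℂ := (((1 / (β * (L : ℝ) ^ 2) : ℝ) : ℂ)) ^ 2 with hc₀
  have hc₀n : ‖c₀‖ = (1 / (β * (L : ℝ) ^ 2)) ^ 2 := by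
    rw [hc₀, norm_pow, Complex.norm_real, Real.norm_eq_abs, abs_of_nonneg (by positivity)]
  set Ψ : TorusSite 1 (2 * M) × TorusSite 2 L → ℂ := fun q =>
    sliceSymbolFnXi (β * (L : ℝ) ^ 2) 0 Λ Λ' (matsubaraFreq β M ⟨(q.1 0).val, ZMod.val_lt (q.1 0)⟩) (nambuXiCT L μ K q.2) with hΨ
  have hB10 : 0 ≤ B₁ := (abs_nonneg _).trans (hB₁ 0)
  have hB20 : 0 ≤ B₂ := (abs_nonneg _).trans (hB₂ 0)
  have hB30 : 0 ≤ B₃ := (abs_nonneg _).trans (hB₃ 0)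
  have hK10 : 0 ≤ K₁ := le_trans (norm_nonneg _) (hK₁ 0)
  have hK20 : 0 ≤ K₂ := le_trans (norm_nonneg _) (hK₂ 0)
  have hK30 : 0 ≤ K₃ := le_trans (norm_nonneg _) (hK₃ 0)
  -- propagator data: sup (everywhere)
  have hΨ0 : ∀ q, ‖Ψ q‖ ≤ 4 * c / Λ := fun q => norm_sliceSymbolTorus_le (K := K) (β := β) (μ := μ) hΛ hΛΛ' hc q
  have hb0 : 0 ≤ 4 * c / Λ := by positivity
  -- the sup of `G`
  have hsup : ∀ q, ‖c₀ * (Mf q * Ψ q)‖ ≤ ‖c₀‖ * (4 * c / Λ) := by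
    intro q
    have h := norm_smul_mul_le_of_support c₀ Mf Ψ zero_le_one hb0 hM0 (fun x _ => hΨ0 x) q
    simpa only [one_mul] using h
  have hA₀ : 0 ≤ ‖c₀‖ * (4 * c / Λ) := by positivity
  -- generic space direction at order three, with tangential datum `τ'` on the support
  have hspace3 : ∀ (r : Fin 2 → ℤ) (τ' a₁ a₂ a₃ : ℝ), 0 ≤ τ' → 0 ≤ a₁ → 0 ≤ a₂ → 0 ≤ a₃ →
      (∀ q, ‖fwdDiff ((0 : TorusSite 1 (2 * M)), (fun j => ((r j : ℤ) : ZMod L))) Mf q‖ ≤ a₁) →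
      (∀ q, ‖(fwdDiff ((0 : TorusSite 1 (2 * M)), (fun j => ((r j : ℤ) : ZMod L))))^[2] Mf q‖ ≤ a₂) →
      (∀ q, ‖(fwdDiff ((0 : TorusSite 1 (2 * M)), (fun j => ((r j : ℤ) : ZMod L))))^[3] Mf q‖ ≤ a₃) →
      (∀ q, Mf q ≠ 0 → |fderiv ℝ (frameLevel μ K) (WithLp.toLp 2 (torusCentredMomentum L q.2))
        (WithLp.toLp 2 (fun i => 2 * π / L * (r i : ℝ)))| ≤ τ') →
      ∀ q, ‖(fwdDiff ((0 : TorusSite 1 (2 * M)), (fun j => ((r j : ℤ) : ZMod L))))^[3] (fun y => c₀ * (Mf y * Ψ y)) q‖ ≤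
        ‖c₀‖ * (1 * ((64 * B₃ + 480 * B₂ + 1728 * B₁ + 1536) * c / Λ ^ 4 *
              (τ' + 6 * (K₂ * ‖(WithLp.toLp 2 (fun j => 2 * π / L * (r j : ℝ)) : EuclideanSpace ℝ (Fin 2))‖ ^ 2)) ^ 3 +
            3 * ((32 * B₂ + 144 * B₁ + 128) * c / Λ ^ 3 *
              (τ' + 6 * (K₂ * ‖(WithLp.toLp 2 (fun j => 2 * π / L * (r j : ℝ)) : EuclideanSpace ℝ (Fin 2))‖ ^ 2)) *
              (K₂ * ‖(WithLp.toLp 2 (fun j => 2 * π / L * (r j : ℝ)) : EuclideanSpace ℝ (Fin 2))‖ ^ 2)) +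
            (16 * B₁ + 16) * c / Λ ^ 2 * (K₃ * ‖(WithLp.toLp 2 (fun j => 2 * π / L * (r j : ℝ)) : EuclideanSpace ℝ (Fin 2))‖ ^ 3)) +
          3 * (a₁ * ((32 * B₂ + 144 * B₁ + 128) * c / Λ ^ 3 *
              (τ' + 5 * (K₂ * ‖(WithLp.toLp 2 (fun j => 2 * π / L * (r j : ℝ)) : EuclideanSpace ℝ (Fin 2))‖ ^ 2)) ^ 2 +
            (16 * B₁ + 16) * c / Λ ^ 2 * (K₂ * ‖(WithLp.toLp 2 (fun j => 2 * π / L * (r j : ℝ)) : EuclideanSpace ℝ (Fin 2))‖ ^ 2))) +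
          3 * (a₂ * ((16 * B₁ + 16) * c / Λ ^ 2 *
              (τ' + 4 * (K₂ * ‖(WithLp.toLp 2 (fun j => 2 * π / L * (r j : ℝ)) : EuclideanSpace ℝ (Fin 2))‖ ^ 2)))) +
          a₃ * (4 * c / Λ)) := by
    intro r τ' a₁ a₂ a₃ hτ' ha₁ ha₂ ha₃ hM1 hM2 hM3' hτr q
    exact norm_fwdDiff_iter_three_smul_mul_le_of_support _ c₀ Mf Ψ zero_le_one ha₁ ha₂ ha₃ hb0 (by positivity) (by positivity)
      (by positivity) hM0 hM1 hM2 hM3' (fun x _ => hΨ0 x)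
      (fun x hx => norm_fwdDiff_space_sliceSymbolTorus_le_of_near_support_three (β := β) hK₂ hΛ hΛΛ' hc hB₁ Mf r hτr x hx)
      (fun x hx => norm_fwdDiff_two_space_sliceSymbolTorus_le_of_near_support_three (β := β) hK₂ hΛ hΛΛ' hc hB₁ hB₂ Mf r hτr x hx)
      (fun x hx => norm_fwdDiff_three_space_sliceSymbolTorus_le_of_near_support (β := β) hK₂ hK₃ hΛ hΛΛ' hc hB₁ hB₂ hB₃ Mf r hτr x hx) q
  -- the space direction `v` at order two (the anisotropic rate), with tangential datum `τ`
  have hspace2 : ∀ q, ‖(fwdDiff ((0 : TorusSite 1 (2 * M)), (fun j => ((v j : ℤ) : ZMod L))))^[2] (fun y => c₀ * (Mf y * Ψ y)) q‖ ≤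
        ‖c₀‖ * (1 * ((32 * B₂ + 144 * B₁ + 128) * c / Λ ^ 3 *
              (τ + 4 * (K₂ * ‖(WithLp.toLp 2 (fun j => 2 * π / L * (v j : ℝ)) : EuclideanSpace ℝ (Fin 2))‖ ^ 2)) ^ 2 +
            (16 * B₁ + 16) * c / Λ ^ 2 * (K₂ * ‖(WithLp.toLp 2 (fun j => 2 * π / L * (v j : ℝ)) : EuclideanSpace ℝ (Fin 2))‖ ^ 2)) +
          2 * (av₁ * ((16 * B₁ + 16) * c / Λ ^ 2 *
              (τ + 3 * (K₂ * ‖(WithLp.toLp 2 (fun j => 2 * π / L * (v j : ℝ)) : EuclideanSpace ℝ (Fin 2))‖ ^ 2)))) +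
          av₂ * (4 * c / Λ)) := by
    intro q
    exact norm_fwdDiff_iter_two_smul_mul_le_of_support _ c₀ Mf Ψ zero_le_one hav₁ hav₂ hb0 (by positivity) (by positivity)
      hM0 hMv₁ hMv₂ (fun x _ => hΨ0 x)
      (fun x hx => norm_fwdDiff_space_sliceSymbolTorus_le_of_near_support (β := β) hK₂ hΛ hΛΛ' hc hB₁ Mf v hτ x hx)
      (fun x hx => norm_fwdDiff_two_space_sliceSymbolTorus_le_of_near_support (β := β) hK₂ hΛ hΛΛ' hc hB₁ hB₂ Mf v hτ x hx) q
  -- the isotropic tangential datum for `e₁, e₂, v⊥`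
  have htriv : ∀ (r : Fin 2 → ℤ) (q : TorusSite 1 (2 * M) × TorusSite 2 L), Mf q ≠ 0 →
      |fderiv ℝ (frameLevel μ K) (WithLp.toLp 2 (torusCentredMomentum L q.2)) (WithLp.toLp 2 (fun i => 2 * π / L * (r i : ℝ)))| ≤
        K₁ * ‖(WithLp.toLp 2 (fun j => 2 * π / L * (r j : ℝ)) : EuclideanSpace ℝ (Fin 2))‖ :=
    fun r q _ => abs_fderiv_apply_le_of_norm_le hK₁ _ _
  -- `Pi.single i 1` as the reduction of the integer vector `Pi.single i 1`
  have hsingle : ∀ i : Fin 2, (Pi.single i (1 : ZMod L) : TorusSite 2 L) = fun j => (((Pi.single i (1 : ℤ) : Fin 2 → ℤ) j : ℤ) : ZMod L) := by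
    intro i; funext j
    by_cases h : j = i
    · subst h; simp
    · simp [h]
  -- assemble via the mixed master lemma
  have hA : ‖c₀‖ * (4 * c / Λ) = (1 / c) ^ 2 * (4 * c / Λ) := by rw [hc₀n]
  rw [← hA]
  intro z₁
  refine sliceCharSumWt_sectional_le_of_mixed_data c₀ Mf Ψ v hv hs₀ hs₁ hs₂ hs₃ hs₃' hR₀ hA₀ hsuppT hsuppS hsup ?_ ?_ ?_ ?_ z₁
  · intro q i
    rw [hsingle i]
    refine (hspace3 (Pi.single i (1 : ℤ)) _ (ae₁ i) (ae₂ i) (ae₃ i) (by positivity) (hae₁ i) (hae₂ i) (hae₃ i)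
      (fun q => by rw [← hsingle i]; exact hMe₁ q i) (fun q => by rw [← hsingle i]; exact hMe₂ q i)
      (fun q => by rw [← hsingle i]; exact hMe₃ q i) (htriv _) q).trans ?_
    rw [hc₀n]; exact hr₁ i
  · intro q
    refine (hspace3 (![-v 1, v 0]) _ an₁ an₂ an₃ (by positivity) han₁ han₂ han₃ hMn₁ hMn₂ hMn₃ (htriv _) q).trans ?_
    rw [hc₀n]; exact hr₂
  · intro q
    refine (hspace2 q).trans ?_
    rw [hc₀n]; exact hr₃
  · intro q
    refine (hspace3 v τ av₁ av₂ av₃ hτ0 hav₁ hav₂ hav₃ hMv₁ hMv₂ hMv₃ hτ q).trans ?_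
    rw [hc₀n]; exact hr₃'

end Pair

end Summit.HubbardSuperconductivity.HubbardSuperconductivity.Theorems.TorusFourierL2

end
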